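import Mathlib
import Summits.ValiantsHypothesis.ValiantsHypothesis.Theorems.LacunarySymmetroidMatrixDescartesPosRootLawDenseTransfer

/-!
# `MatrixDescartes` (stmt-ValiantsHypothesis-18050), line `osculation_law`, stub `stub_recursion` — R5 in the TREE currency:
# the `K`-induction `PosRootLawAt m K (B K) → PosRootLawAt m (K+1) (B (K+1))` by DENSE TRANSFER AT EVERY STEP, and the
# exponent envelope `B(m,K) ≤ 2^(C (K + log₂² m))`

Helper file (`--supports stmt-ValiantsHypothesis-18050 --as helper`; cell val-lit, seat val-port-3 g1, merged desk g12,
RULING #284 (b) «shape reviewer of `recursion_of_GP`»; spec `HOME/lmr/SPEC-p8g12-18050-stub_recursion-R3R5.md` R5).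
Closes NO item.

Shape.  The analytic content of one recursion node (spec R3/R4: top-letter split `S_K = YᵀY − c·1`, congruence, the
two peel steps `hP`, the osculation law `hO`, simple positive roots of the previous determinant) is taken here as ONE
black-box hypothesis `hstep` on a NODE family `N K d` of `(K+1)`-letter pencils on the support `d`:
every pencil of the family has at most `4 · (#distinct positive det-roots of its first K letters) + A K` positive
det-roots COUNTED WITH MULTIPLICITY.  The only other hypothesis is DENSITY of the node family among the symmetric
pencils on each support in normal form (`d` strictly increasing, `d 0 = 0`) — the line's honest general-position
residue, node-local.  From these:

* `posRootLawAt_succ_of_nodeStep` — ONE STEP: `PosRootLawAt m K B` + node step with additive cost `A` + node density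
  ⇒ `PosRootLawAt m (K+1) (4 B + A)` (dense transfer `DenseTransfer.card_posRoots_le_of_dense_mult` on the support,
  the induction hypothesis BY NAME on the first `K` letters);
* `recBound_succ` and `posRootLawAt_of_nodeSteps` — THE INDUCTION: `PosRootLawAt m K (∑_{j<K} 4^(K-1-j) · A j)`
  for every `K` (the closed form of `R_0 = 0`, `R_{K+1} = 4 R_K + A K`; no new definition);
* `three_mul_recBound_add_le`, `recBound_le_pow_mul` — `R_K ≤ 4^K · M` whenever `A j ≤ M` for `j < K`;
* `le_two_pow_log_sq_succ` — `m ≤ 2 ^ (Nat.log 2 m ^ 2 + 1)`;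
* **`exists_exponent_envelope`** — if `A m K ≤ a · 2^(C₀ (K + 1 + log₂² m)) + b · m` for all `m, K`, then
  `∃ C, ∀ m K, R_K ≤ 2 ^ (C (K + log₂² m))`;
* **`posKPlusLogSq_of_nodeSteps`** — ASSEMBLY: node families dense on normal-form supports + node steps with such a
  cost `A` ⇒ `∃ C, ∀ m K, PosRootLawAt m K (2 ^ (C (K + log₂² m)))` (= the line's `PosKPlusLogSqLaw`, unfolded);
* `…_reindex` twins of the step / induction / assembly for node families on a reindexed format `ι ≃ Fin m`
  (`Fin m ⊕ Fin 0`, where the peel inequality is consumed at the splitting `(m, 0)`).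

[folklore] Induction and arithmetic only.  Honest framing: bookkeeping toward an OPEN stub of a LAW line; the node
step (R3/R4), the node density (R6(a)), the osculation LAW, `MatrixDescartes` (18050), Conjecture B and VP ≠ VNP are
NOT proved here.
-/

set_option linter.dupNamespace false

namespace Summit.ValiantsHypothesis.ValiantsHypothesis.Theorems.LacunarySymmetroidMatrixDescartes.RecursionTransfer

open Polynomial Matrix Filter Topology
open scoped BigOperators
open Summit.ValiantsHypothesis.ValiantsHypothesis.Theorems.MatrixDescartes.Negative (PosRootLawAt)

variable {m : ℕ}

/-! ## One step -/

/-- **One recursion step in the tree currency.**  Let `N` be a family of `(K+1)`-letter `m × m` pencils on the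
normal-form support `d` such that every `S' ∈ N` is symmetric and has at most
`4 · #(distinct positive det-roots of its first K letters on init d) + A` positive det-roots counted with
multiplicity (the analytic node step), and such that every symmetric `(K+1)`-letter family lies in the closure of `N`.
If `PosRootLawAt m K B`, then every symmetric pencil on `d` has at most `4 B + A` distinct positive det-roots.
[folklore] -/
theorem card_posRoots_le_of_nodeStep {K B A : ℕ} (hIH : PosRootLawAt m K B) (d : Fin (K + 1) → ℕ)
    (N : Set (Fin (K + 1) → Matrix (Fin m) (Fin m) ℝ))
    (hNsymm : ∀ S' ∈ N, ∀ l, (S' l).IsSymm)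
    (hstep : ∀ S' ∈ N,
      Multiset.card (((∑ l, (X : ℝ[X]) ^ d l • (S' l).map C).det.roots.filter (fun t => 0 < t))) ≤
        4 * ((∑ l, (X : ℝ[X]) ^ (Fin.init d) l • ((Fin.init S') l).map C).det.roots.toFinset.filter
          (fun t => 0 < t)).card + A)
    (hdense : ∀ (S : Fin (K + 1) → Matrix (Fin m) (Fin m) ℝ), (∀ l, (S l).IsSymm) → S ∈ closure N)
    (S : Fin (K + 1) → Matrix (Fin m) (Fin m) ℝ) (hS : ∀ l, (S l).IsSymm) :
    ((∑ l, (X : ℝ[X]) ^ d l • (S l).map C).det.roots.toFinset.filter (fun t => 0 < t)).card ≤ 4 * B + A := by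
  refine DenseTransfer.card_posRoots_le_of_dense_mult d N hdense (fun S' hS' => ?_) S hS
  have hinit : ((∑ l, (X : ℝ[X]) ^ (Fin.init d) l • ((Fin.init S') l).map C).det.roots.toFinset.filter
      (fun t => 0 < t)).card ≤ B :=
    hIH (Fin.init d) (Fin.init S') fun l => hNsymm S' hS' _
  exact (hstep S' hS').trans (by omega)

/-- **One step, format level.**  Node families `N d` as above on every normal-form support `d` (`StrictMono d`,
`d 0 = 0`) and `PosRootLawAt m K B` give `PosRootLawAt m (K + 1) (4 B + A)`. [folklore] -/
theorem posRootLawAt_succ_of_nodeStep {K B A : ℕ} (hIH : PosRootLawAt m K B)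
    (N : (Fin (K + 1) → ℕ) → Set (Fin (K + 1) → Matrix (Fin m) (Fin m) ℝ))
    (hNsymm : ∀ d, StrictMono d → d 0 = 0 → ∀ S' ∈ N d, ∀ l, (S' l).IsSymm)
    (hstep : ∀ d, StrictMono d → d 0 = 0 → ∀ S' ∈ N d,
      Multiset.card (((∑ l, (X : ℝ[X]) ^ d l • (S' l).map C).det.roots.filter (fun t => 0 < t))) ≤
        4 * ((∑ l, (X : ℝ[X]) ^ (Fin.init d) l • ((Fin.init S') l).map C).det.roots.toFinset.filter
          (fun t => 0 < t)).card + A)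
    (hdense : ∀ d, StrictMono d → d 0 = 0 →
      ∀ (S : Fin (K + 1) → Matrix (Fin m) (Fin m) ℝ), (∀ l, (S l).IsSymm) → S ∈ closure (N d)) :
    PosRootLawAt m (K + 1) (4 * B + A) := by
  rw [Census.posRootLawAt_iff_strictMono]
  intro d hd h0 S hS
  exact card_posRoots_le_of_nodeStep hIH d (N d) (hNsymm d hd h0) (hstep d hd h0) (hdense d hd h0) S hS

/-- **One recursion step, node family on a reindexed format** (`ι ≃ Fin m`, e.g. `ι = Fin m ⊕ Fin 0` on which the
line's peel step is stated).  Same as `card_posRoots_le_of_nodeStep`, the node family living on `ι`-indexed letters;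
the induction hypothesis is transported along `DenseTransfer.det_pencil_reindex`. [folklore] -/
theorem card_posRoots_le_of_nodeStep_reindex {K B A : ℕ} {ι : Type*} [Fintype ι] [DecidableEq ι] (e : ι ≃ Fin m)
    (hIH : PosRootLawAt m K B) (d : Fin (K + 1) → ℕ) (N : Set (Fin (K + 1) → Matrix ι ι ℝ))
    (hNsymm : ∀ S' ∈ N, ∀ l, (S' l).IsSymm)
    (hstep : ∀ S' ∈ N,
      Multiset.card (((∑ l, (X : ℝ[X]) ^ d l • (S' l).map C).det.roots.filter (fun t => 0 < t))) ≤
        4 * ((∑ l, (X : ℝ[X]) ^ (Fin.init d) l • ((Fin.init S') l).map C).det.roots.toFinset.filter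
          (fun t => 0 < t)).card + A)
    (hdense : ∀ (S : Fin (K + 1) → Matrix ι ι ℝ), (∀ l, (S l).IsSymm) → S ∈ closure N)
    (S : Fin (K + 1) → Matrix (Fin m) (Fin m) ℝ) (hS : ∀ l, (S l).IsSymm) :
    ((∑ l, (X : ℝ[X]) ^ d l • (S l).map C).det.roots.toFinset.filter (fun t => 0 < t)).card ≤ 4 * B + A := by
  refine DenseTransfer.card_posRoots_le_of_dense_mult_reindex e d N hdense (fun S' hS' => ?_) S hS
  have h := hIH (Fin.init d) (fun l => Matrix.reindex e e (Fin.init S' l))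
    (fun l => DenseTransfer.isSymm_reindex e (hNsymm S' hS' _))
  have hdet : (∑ l, (X : ℝ[X]) ^ (Fin.init d) l •
      ((fun l => Matrix.reindex e e (Fin.init S' l)) l).map C).det =
      (∑ l, (X : ℝ[X]) ^ (Fin.init d) l • ((Fin.init S') l).map C).det :=
    DenseTransfer.det_pencil_reindex e (Fin.init d) (Fin.init S')
  rw [hdet] at h
  exact (hstep S' hS').trans (by omega)

/-- **One step, format level, node families on a reindexed format `ι ≃ Fin m`.** [folklore] -/
theorem posRootLawAt_succ_of_nodeStep_reindex {K B A : ℕ} {ι : Type*} [Fintype ι] [DecidableEq ι] (e : ι ≃ Fin m)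
    (hIH : PosRootLawAt m K B) (N : (Fin (K + 1) → ℕ) → Set (Fin (K + 1) → Matrix ι ι ℝ))
    (hNsymm : ∀ d, StrictMono d → d 0 = 0 → ∀ S' ∈ N d, ∀ l, (S' l).IsSymm)
    (hstep : ∀ d, StrictMono d → d 0 = 0 → ∀ S' ∈ N d,
      Multiset.card (((∑ l, (X : ℝ[X]) ^ d l • (S' l).map C).det.roots.filter (fun t => 0 < t))) ≤
        4 * ((∑ l, (X : ℝ[X]) ^ (Fin.init d) l • ((Fin.init S') l).map C).det.roots.toFinset.filter
          (fun t => 0 < t)).card + A)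
    (hdense : ∀ d, StrictMono d → d 0 = 0 →
      ∀ (S : Fin (K + 1) → Matrix ι ι ℝ), (∀ l, (S l).IsSymm) → S ∈ closure (N d)) :
    PosRootLawAt m (K + 1) (4 * B + A) := by
  rw [Census.posRootLawAt_iff_strictMono]
  intro d hd h0 S hS
  exact card_posRoots_le_of_nodeStep_reindex e hIH d (N d) (hNsymm d hd h0) (hstep d hd h0) (hdense d hd h0) S hS

/-! ## The induction -/

/-- The recursion bound `R_K = ∑_{j<K} 4^(K-1-j) · A j` (closed form of `R_0 = 0`, `R_{K+1} = 4 R_K + A K`) satisfies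
its recurrence. [folklore] -/
theorem recBound_succ (A : ℕ → ℕ) (K : ℕ) :
    ∑ j ∈ Finset.range (K + 1), 4 ^ (K + 1 - 1 - j) * A j =
      4 * (∑ j ∈ Finset.range K, 4 ^ (K - 1 - j) * A j) + A K := by
  rw [Finset.sum_range_succ, Finset.mul_sum]
  congr 1
  · refine Finset.sum_congr rfl fun j hj => ?_
    rw [Finset.mem_range] at hj
    have h : K + 1 - 1 - j = (K - 1 - j) + 1 := by omega
    rw [h, pow_succ]
    ring
  · simp

/-- **The `K`-induction.**  Node families on every format `K + 1` (symmetric members, analytic node step with cost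
`A K`, dense among symmetric pencils on every normal-form support) give `PosRootLawAt m K (∑_{j<K} 4^(K-1-j) · A j)`
for EVERY `K` (base `K = 0`: `DenseTransfer.posRootLawAt_zero_letters`). [folklore] -/
theorem posRootLawAt_of_nodeSteps (A : ℕ → ℕ)
    (N : (K : ℕ) → (Fin (K + 1) → ℕ) → Set (Fin (K + 1) → Matrix (Fin m) (Fin m) ℝ))
    (hNsymm : ∀ K d, StrictMono d → d 0 = 0 → ∀ S' ∈ N K d, ∀ l, (S' l).IsSymm)
    (hstep : ∀ K d, StrictMono d → d 0 = 0 → ∀ S' ∈ N K d,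
      Multiset.card (((∑ l, (X : ℝ[X]) ^ d l • (S' l).map C).det.roots.filter (fun t => 0 < t))) ≤
        4 * ((∑ l, (X : ℝ[X]) ^ (Fin.init d) l • ((Fin.init S') l).map C).det.roots.toFinset.filter
          (fun t => 0 < t)).card + A K)
    (hdense : ∀ K d, StrictMono d → d 0 = 0 →
      ∀ (S : Fin (K + 1) → Matrix (Fin m) (Fin m) ℝ), (∀ l, (S l).IsSymm) → S ∈ closure (N K d)) :
    ∀ K, PosRootLawAt m K (∑ j ∈ Finset.range K, 4 ^ (K - 1 - j) * A j) := by
  intro K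
  induction K with
  | zero => simpa using DenseTransfer.posRootLawAt_zero_letters (m := m) 0
  | succ K ih =>
    rw [recBound_succ]
    exact posRootLawAt_succ_of_nodeStep ih (N K) (hNsymm K) (hstep K) (hdense K)

/-- **The `K`-induction, node families on a reindexed format `ι ≃ Fin m`.** [folklore] -/
theorem posRootLawAt_of_nodeSteps_reindex {ι : Type*} [Fintype ι] [DecidableEq ι] (e : ι ≃ Fin m) (A : ℕ → ℕ)
    (N : (K : ℕ) → (Fin (K + 1) → ℕ) → Set (Fin (K + 1) → Matrix ι ι ℝ))
    (hNsymm : ∀ K d, StrictMono d → d 0 = 0 → ∀ S' ∈ N K d, ∀ l, (S' l).IsSymm)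
    (hstep : ∀ K d, StrictMono d → d 0 = 0 → ∀ S' ∈ N K d,
      Multiset.card (((∑ l, (X : ℝ[X]) ^ d l • (S' l).map C).det.roots.filter (fun t => 0 < t))) ≤
        4 * ((∑ l, (X : ℝ[X]) ^ (Fin.init d) l • ((Fin.init S') l).map C).det.roots.toFinset.filter
          (fun t => 0 < t)).card + A K)
    (hdense : ∀ K d, StrictMono d → d 0 = 0 →
      ∀ (S : Fin (K + 1) → Matrix ι ι ℝ), (∀ l, (S l).IsSymm) → S ∈ closure (N K d)) :
    ∀ K, PosRootLawAt m K (∑ j ∈ Finset.range K, 4 ^ (K - 1 - j) * A j) := by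
  intro K
  induction K with
  | zero => simpa using DenseTransfer.posRootLawAt_zero_letters (m := m) 0
  | succ K ih =>
    rw [recBound_succ]
    exact posRootLawAt_succ_of_nodeStep_reindex e ih (N K) (hNsymm K) (hstep K) (hdense K)

/-! ## The exponent envelope -/

/-- `3 · R_K + M ≤ 4^K · M` when `A j ≤ M` for all `j < K` (geometric sum). [folklore] -/
theorem three_mul_recBound_add_le (A : ℕ → ℕ) (M K : ℕ) (hA : ∀ j < K, A j ≤ M) :
    3 * (∑ j ∈ Finset.range K, 4 ^ (K - 1 - j) * A j) + M ≤ 4 ^ K * M := by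
  induction K with
  | zero => simp
  | succ K ih =>
    have h1 := ih fun j hj => hA j (by omega)
    have h2 := hA K (by omega)
    rw [recBound_succ, pow_succ]
    nlinarith

/-- `R_K ≤ 4^K · M` when `A j ≤ M` for all `j < K`. [folklore] -/
theorem recBound_le_pow_mul (A : ℕ → ℕ) (M K : ℕ) (hA : ∀ j < K, A j ≤ M) :
    ∑ j ∈ Finset.range K, 4 ^ (K - 1 - j) * A j ≤ 4 ^ K * M := by
  have := three_mul_recBound_add_le A M K hA
  omega

/-- `m ≤ 2 ^ (log₂² m + 1)`. [folklore] -/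
theorem le_two_pow_log_sq_succ (m : ℕ) : m ≤ 2 ^ (Nat.log 2 m ^ 2 + 1) := by
  have h1 : m < 2 ^ (Nat.log 2 m + 1) := Nat.lt_pow_succ_log_self (by norm_num) m
  have h2 : Nat.log 2 m ≤ Nat.log 2 m ^ 2 := by
    rcases Nat.eq_zero_or_pos (Nat.log 2 m) with h | h
    · rw [h]; simp
    · calc Nat.log 2 m = Nat.log 2 m * 1 := (mul_one _).symm
        _ ≤ Nat.log 2 m * Nat.log 2 m := Nat.mul_le_mul_left _ h
        _ = Nat.log 2 m ^ 2 := (sq _).symm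
  have h3 : 2 ^ (Nat.log 2 m + 1) ≤ 2 ^ (Nat.log 2 m ^ 2 + 1) := Nat.pow_le_pow_right (by norm_num) (by omega)
  omega

/-- **Exponent envelope.**  If the node cost is `A m K ≤ a · 2^(C₀ (K + 1 + log₂² m)) + b · m`, then the recursion
bound `∑_{j<K} 4^(K-1-j) · A m j` is `≤ 2 ^ (C (K + log₂² m))` for one absolute `C` (depending on `a, b, C₀`).
[folklore] -/
theorem exists_exponent_envelope (A : ℕ → ℕ → ℕ) (a b C₀ : ℕ)
    (hA : ∀ m K, A m K ≤ a * 2 ^ (C₀ * (K + 1 + Nat.log 2 m ^ 2)) + b * m) :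
    ∃ C : ℕ, ∀ m K, ∑ j ∈ Finset.range K, 4 ^ (K - 1 - j) * A m j ≤ 2 ^ (C * (K + Nat.log 2 m ^ 2)) := by
  -- `a ≤ 2^a`, `b ≤ 2^b`; everything is absorbed into one exponent linear in `K + L`, `L = log₂² m`
  refine ⟨2 * C₀ + a + b + 6, fun m K => ?_⟩
  set L := Nat.log 2 m ^ 2 with hL
  rcases Nat.eq_zero_or_pos K with hK | hK
  · subst hK; simp
  -- uniform bound on the costs below level K
  have hM : ∀ j < K, A m j ≤ 2 ^ (C₀ * (K + L) + a + b + L + 2) := by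
    intro j hj
    have h1 := hA m j
    have ha : a ≤ 2 ^ a := Nat.lt_two_pow_self.le
    have hb : b ≤ 2 ^ b := Nat.lt_two_pow_self.le
    have hm : m ≤ 2 ^ (L + 1) := le_two_pow_log_sq_succ m
    have hC : 2 ^ (C₀ * (j + 1 + L)) ≤ 2 ^ (C₀ * (K + L)) :=
      Nat.pow_le_pow_right (by norm_num) (Nat.mul_le_mul_left _ (by omega))
    have e1 : a * 2 ^ (C₀ * (j + 1 + L)) ≤ 2 ^ a * 2 ^ (C₀ * (K + L)) := Nat.mul_le_mul ha hC
    have e2 : b * m ≤ 2 ^ b * 2 ^ (L + 1) := Nat.mul_le_mul hb hm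
    have e3 : 2 ^ a * 2 ^ (C₀ * (K + L)) ≤ 2 ^ (C₀ * (K + L) + a + b + L + 1) := by
      rw [← pow_add]; exact Nat.pow_le_pow_right (by norm_num) (by omega)
    have e4 : 2 ^ b * 2 ^ (L + 1) ≤ 2 ^ (C₀ * (K + L) + a + b + L + 1) := by
      rw [← pow_add]; exact Nat.pow_le_pow_right (by norm_num) (by omega)
    calc A m j ≤ a * 2 ^ (C₀ * (j + 1 + L)) + b * m := h1
      _ ≤ 2 ^ (C₀ * (K + L) + a + b + L + 1) + 2 ^ (C₀ * (K + L) + a + b + L + 1) :=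
          Nat.add_le_add (e1.trans e3) (e2.trans e4)
      _ = 2 ^ (C₀ * (K + L) + a + b + L + 2) := by rw [← two_mul, ← pow_succ']
  have hrec := recBound_le_pow_mul (A m) _ K hM
  have h4 : (4 : ℕ) ^ K = 2 ^ (2 * K) := by rw [pow_mul]; norm_num
  rw [h4, ← pow_add] at hrec
  refine hrec.trans (Nat.pow_le_pow_right (by norm_num) ?_)
  -- 2K + C₀(K+L) + a + b + L + 2 ≤ (2C₀ + a + b + 6)(K + L), using K ≥ 1
  have hKL : 1 ≤ K + L := by omega
  nlinarith [hKL, Nat.zero_le L, Nat.zero_le (C₀ * L), Nat.zero_le a, Nat.zero_le b]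

/-! ## Assembly -/

/-- **`PosKPlusLogSqLaw` from node steps** (the line's target currency, unfolded:
`∃ C, ∀ m K, PosRootLawAt m K (2 ^ (C * (K + Nat.log 2 m ^ 2)))`).  Hypotheses, for every size `m`: node families
`N m K d` of symmetric `(K+1)`-letter pencils, DENSE among the symmetric pencils on every normal-form support (the
general-position residue R6(a)), on which the analytic node step holds with a cost
`A m K ≤ a · 2^(C₀ (K + 1 + log₂² m)) + b · m` (R3/R4 fed by the peel inequality and the osculation law). [folklore] -/
theorem posKPlusLogSq_of_nodeSteps (A : ℕ → ℕ → ℕ) (a b C₀ : ℕ)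
    (hA : ∀ m K, A m K ≤ a * 2 ^ (C₀ * (K + 1 + Nat.log 2 m ^ 2)) + b * m)
    (N : (m K : ℕ) → (Fin (K + 1) → ℕ) → Set (Fin (K + 1) → Matrix (Fin m) (Fin m) ℝ))
    (hNsymm : ∀ m K d, StrictMono d → d 0 = 0 → ∀ S' ∈ N m K d, ∀ l, (S' l).IsSymm)
    (hstep : ∀ m K d, StrictMono d → d 0 = 0 → ∀ S' ∈ N m K d,
      Multiset.card (((∑ l, (X : ℝ[X]) ^ d l • (S' l).map C).det.roots.filter (fun t => 0 < t))) ≤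
        4 * ((∑ l, (X : ℝ[X]) ^ (Fin.init d) l • ((Fin.init S') l).map C).det.roots.toFinset.filter
          (fun t => 0 < t)).card + A m K)
    (hdense : ∀ m K d, StrictMono d → d 0 = 0 →
      ∀ (S : Fin (K + 1) → Matrix (Fin m) (Fin m) ℝ), (∀ l, (S l).IsSymm) → S ∈ closure (N m K d)) :
    ∃ C : ℕ, ∀ m K : ℕ, PosRootLawAt m K (2 ^ (C * (K + Nat.log 2 m ^ 2))) := by
  obtain ⟨C, hC⟩ := exists_exponent_envelope A a b C₀ hA
  refine ⟨C, fun m K d S hS => ?_⟩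
  exact (posRootLawAt_of_nodeSteps (A m) (N m) (hNsymm m) (hstep m) (hdense m) K d S hS).trans (hC m K)

/-- **`PosKPlusLogSqLaw` from node steps on reindexed formats** (`ι m ≃ Fin m` for every size, e.g.
`ι m = Fin m ⊕ Fin 0`, `e m = Equiv.sumEmpty _ _` — the format on which the line's peel inequality is consumed).
[folklore] -/
theorem posKPlusLogSq_of_nodeSteps_reindex (ι : ℕ → Type*) [∀ m, Fintype (ι m)] [∀ m, DecidableEq (ι m)]
    (e : ∀ m, ι m ≃ Fin m) (A : ℕ → ℕ → ℕ) (a b C₀ : ℕ)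
    (hA : ∀ m K, A m K ≤ a * 2 ^ (C₀ * (K + 1 + Nat.log 2 m ^ 2)) + b * m)
    (N : (m K : ℕ) → (Fin (K + 1) → ℕ) → Set (Fin (K + 1) → Matrix (ι m) (ι m) ℝ))
    (hNsymm : ∀ m K d, StrictMono d → d 0 = 0 → ∀ S' ∈ N m K d, ∀ l, (S' l).IsSymm)
    (hstep : ∀ m K d, StrictMono d → d 0 = 0 → ∀ S' ∈ N m K d,
      Multiset.card (((∑ l, (X : ℝ[X]) ^ d l • (S' l).map C).det.roots.filter (fun t => 0 < t))) ≤
        4 * ((∑ l, (X : ℝ[X]) ^ (Fin.init d) l • ((Fin.init S') l).map C).det.roots.toFinset.filter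
          (fun t => 0 < t)).card + A m K)
    (hdense : ∀ m K d, StrictMono d → d 0 = 0 →
      ∀ (S : Fin (K + 1) → Matrix (ι m) (ι m) ℝ), (∀ l, (S l).IsSymm) → S ∈ closure (N m K d)) :
    ∃ C : ℕ, ∀ m K : ℕ, PosRootLawAt m K (2 ^ (C * (K + Nat.log 2 m ^ 2))) := by
  obtain ⟨C, hC⟩ := exists_exponent_envelope A a b C₀ hA
  refine ⟨C, fun m K d S hS => ?_⟩
  exact (posRootLawAt_of_nodeSteps_reindex (e m) (A m) (N m) (hNsymm m) (hstep m) (hdense m) K d S hS).trans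
    (hC m K)

end Summit.ValiantsHypothesis.ValiantsHypothesis.Theorems.LacunarySymmetroidMatrixDescartes.RecursionTransfer
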